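import Literature.Geometry.Riemannian.AlmostNonnegRicciFibrationPrecompact
import Literature.Geometry.MetricGeometry.UltralimitGroup
import HarnessLib

/-!
# Huang–Huang–Wang–Zhu 2026, Main Theorem 1 at `n = 4`, `b₁ = 1`: the limit group of the deck
actions of a contradiction sequence

Eighth reduction file for the named fact
`Literature.Geometry.Riemannian.huangHuangWangZhu2026_fibresOverCircle_four`. For a contradiction
sequence `D : (i : ℕ) → CoreDatum κ (δ i)` with base points `p̂ᵢ` on the covers `M̂ᵢ = (D i).Cover`,
the deck groups `Hᵢ ≅ ℤ` act by isometries (`AlmostNonnegRicciFibrationCovers.lean`); in the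
ultralimit realisation of the limit `(M̂ᵢ, p̂ᵢ) → (Y, q)` (`AlmostNonnegRicciFibrationPrecompact.lean`)
the limit group `H ≤ Isom(Y)` of Huang–Huang–Wang–Zhu 2026, §4 p. 13 (diagram (4.1),
"`(M̂ᵢ, p̂ᵢ, Hᵢ) → (ℝˢ × Ŷ, (0ˢ, ŷ_∞), H)`") is the `limitGroup` of
`MetricGeometry/UltralimitGroup.lean` for `Γᵢ = Multiplicative ℤ`. This file records the two
properties of `H` used on p. 13:

* `CoreDatum.deckLimitGroup_mul_comm` — **"`H` is Abelian"**;
* `CoreDatum.exists_mem_deckLimitGroup_dist_basePt_le_one` — **`H` moves every point of the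
  limit into the closed unit ball about the base point** (the deck actions are cocompact at scale
  `1` because `diam Mᵢ ≤ 1`; "`diam(ℝˢ/G) ≤ 1`").

Proved theorems and one abbreviation; no named facts; (E) untouched.

## References

* H. Huang, X.-T. Huang, J. Wang, X. Zhu, arXiv:2605.24380 (2026), §2.1 p. 6 (Thm 2.1), §4 p. 13.
  [HuangHuangWangZhu2026]
-/

noncomputable section

open scoped Manifold ContDiff Topology
open Function Set Filter Metric

namespace Literature.Geometry.Riemannian

open Literature.Geometry.MetricGeometry Literature.Topology.FourManifolds.CircleMaps

namespace CoreDatum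

variable {κ : ℝ} {δ : ℕ → ℝ} (D : (i : ℕ) → CoreDatum κ (δ i)) (p : ∀ i, (D i).Cover)

/-- The deck actions of a sequence of data are isometric, as an instance family (under the cover
metric spaces). [cite: HuangHuangWangZhu2026, §4 p. 13] -/
theorem isIsometricVAdd_covers :
    letI := coverMetricSpaces D
    ∀ i, IsIsometricVAdd ℤ ((D i).Cover) := by
  letI := coverMetricSpaces D
  exact fun i ↦ (D i).isIsometricVAdd_cover

/-- **The limit group `H` of the deck groups `Hᵢ ≅ ℤ`** on the ultralimit of the covers (along the
hyperfilter): the `limitGroup` of the isometric actions of `Multiplicative ℤ`.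
[cite: HuangHuangWangZhu2026, §4 p. 13] -/
abbrev deckLimitGroup :
    letI := coverMetricSpaces D
    Subgroup (Ultralimit p (hyperfilter ℕ) ≃ᵢ Ultralimit p (hyperfilter ℕ)) :=
  letI := coverMetricSpaces D
  haveI := isIsometricVAdd_covers D
  Ultralimit.limitGroup (fun _ ↦ Multiplicative ℤ) p (hyperfilter ℕ)

/-- **"`H` is Abelian"** (Huang–Huang–Wang–Zhu 2026, §4 p. 13): the limit group of the deck groups
is commutative. [cite: HuangHuangWangZhu2026, §4 p. 13] -/
theorem deckLimitGroup_mul_comm :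
    letI := coverMetricSpaces D
    ∀ A ∈ deckLimitGroup D p, ∀ B ∈ deckLimitGroup D p, A * B = B * A := by
  letI := coverMetricSpaces D
  haveI := isIsometricVAdd_covers D
  intro A hA B hB
  exact Ultralimit.limitGroup_mul_comm (fun _ a b ↦ mul_comm a b) hA hB

/-- **The limit group moves every point into the unit ball about the base point**
("`diam(ℝˢ/G) ≤ 1`", Huang–Huang–Wang–Zhu 2026, §4 p. 13, for `b = 1`): the deck actions on the
covers of manifolds of diameter `≤ 1` are cocompact at scale `1`
(`exists_vadd_mem_closedBall_one`), and cocompactness passes to the ultralimit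
(`exists_mem_limitGroup_dist_basePt_le`). [cite: HuangHuangWangZhu2026, §4 p. 13] -/
theorem exists_mem_deckLimitGroup_dist_basePt_le_one :
    letI := coverMetricSpaces D
    ∀ y : Ultralimit p (hyperfilter ℕ), ∃ A ∈ deckLimitGroup D p,
      dist (A y) (Ultralimit.basePt p (hyperfilter ℕ)) ≤ 1 := by
  letI := coverMetricSpaces D
  haveI := isIsometricVAdd_covers D
  intro y
  refine Ultralimit.exists_mem_limitGroup_dist_basePt_le (Γ := fun _ ↦ Multiplicative ℤ) (fun i x ↦ ?_) y
  obtain ⟨k, hk⟩ := (D i).exists_vadd_mem_closedBall_one (p i) x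
  exact ⟨Multiplicative.ofAdd k, mem_closedBall.1 hk⟩

end CoreDatum

end Literature.Geometry.Riemannian
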